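import Summits.CriticalPhenomena.PercolationContinuityZ3.Theorems.Transplant.SkelKits
import Summits.CriticalPhenomena.PercolationContinuityZ3.Theorems.Transplant.SkelSlabCube
import Summits.CriticalPhenomena.PercolationContinuityZ3.Theorems.Transplant.SkelConcKitsOrthant
import Summits.CriticalPhenomena.PercolationContinuityZ3.Theorems.Transplant.SkelConcRootAssembly
import HarnessLib

/-!
# L6 (R), file 8: THE KIT CLAUSES OF THE ROOT RUN — `Skel.hkits_rootWAD` — and the root residue of the concentric scheme of record with
# them DISCHARGED — `Skel.rootOblA_concSG_kits` (generic twin of `KNCellsBoxProdZ2ConcRootKits.hkits_rootTAD` / `rootOblA_concG_raw`)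

builds on p205010 (kernel theorem, internal audit signed; external expert review pending) — nothing in this file uses p205010.
Status sentence (coordinator 2026-08-20T04:30Z): "θ(p_c) = 0 on ℤ^d, all d ≥ 2 — kernel-verified (Lean 4/Mathlib, standard axioms); internal
adversarial audit SIGNED 2026-08-20 04:29Z; external expert review pending."
Lane `prim-bschramm-*`, seat `prim-bschramm-p2` (gen 5; (R) = p2 lineage, SHEAR-SCOPE §3.9 Layer 6); helper file (`--supports stmt-CriticalPhenomena-4575`).

For every direction `du`, every root step `k ≤ 44` and every level `j ∈ [j₀, j₁]` of the straight-run window data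
`P = Skel.rootWAD Φ w₀ Rt L' du t R' ℓ₀ ca cb q' Rlev N j₀ j₁ (rootUS …)` the per-level kit clause of `Skel.rootOblA_of_rootRunSG` /
`rootOblA_concSG_raw` (hypothesis `hkits`) is p1-g7's `SkelI.kitClause` (L5.9, seed slab v3) with p3-g4's Lemma-9 cube faces (`SkelSlabCube`: the body of p1's `kitClause_cube`) at the window
step `(winGraph G w₀ Rt, levels B⟨j⟩ of core k, region D_k = Win w₀ region_k Rt, enlarged target T_k = Win w₀ core_{k+1} Rt ∪ Rim_k)` under the
cut root law `W0sub (rootUS …)`, with its per-contact dichotomy `hcon` from `SkelI.hcon_win₂_of_roomO` (SkelConcKitsOrthant): far and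
near-rim contacts take the face-in-target branch through `Rim_k` (= the region's window vertices deeper than `Rt − L'`), deep contacts a straight
quarter-face route of scale `ℓ ∈ [ℓ₀, t + R']` from the planar room `ChainPlanar.Adv.levelBox_room` (orthant face towards the run's centre line);
the subbox / level / width facts are p2-g4's `isSubbox_rootWAD`, `WinAdvData.level_subset_stepD`, `ChainPlanar.Adv.levelBox_wide`.
Constants: p1-g7's nine seed-kit inequalities (`ℓs ≥ M+1`, `R′_seed`, `r₀`, `rs`), `r₀ ≤ L'`, `T₀ = tanOff ℓs M ≤ j₀` (the cores `k ≥ 1` have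
zero axial width, so the level box of `B⟨j⟩` is exactly `2j` wide along the axis), `ψ(t+R') + ψ M ≤ L' ≤ Rt`, `M < ℓ₀`, `[ℓ₀, t+R'] ∪ {M} ⊆ Ssc`,
counts `kk (Δ+1)^{2rs} ≤ N`, `(1 − q^{sB})^{kk} ≤ δ`.
* §1 `hwide_rootWAD`, `φ_cubeCtr_mem_levelBox`, **`hkits_rootWAD`**;
* §2 **`rootOblA_concSG_kits`** — `rootOblA_concSG_raw` with `hkits` AND the first-hop link `hlink` discharged from the Step-I input family at
  the running parameter (`Skel.exists_inputs_at_center_all` at the first-hop centre, scale `6t ∈ Ssc`, seed `msel t ≤ M`, `m := M`).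
[cite: KozmaNitzan2024, §4 Lemma 10 Steps III–IV (pp. 19–21), Lemma 11 (pp. 22–23), Lemma 12 (p. 24), p. 28 ((32) at the root)]
-/

noncomputable section

open MeasureTheory ProbabilityTheory
open scoped ENNReal Classical

namespace Summit.CriticalPhenomena.PercolationContinuityZ3.Theorems

namespace Transplant

namespace Skel

open Literature.Probability.Percolation Literature.Probability.LatticeModels SimpleGraph GadgetSystem ProbeHistory HSiteScheme Contour KNCells
open Literature.Probability.Percolation.KozmaNitzan
open Literature.Probability.Percolation.GM (HOct)
open Literature.Probability.Percolation.KozmaNitzan.Cells (sgOf sgOf_sign)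
open KNCells.KSchA PlanarSkeletonConc KNLevels ChainPlanar
open Literature.Barriers.CriticalPhenomena (graphBall mem_graphBall_self graphBall_mono)
open BoxProdZ2 (ConcRadiiG rootρ rootCtr RootRunOK RootRunOKN rootRun_advOK rootV rootV_fst rootV_oth sgUnit sgUnit_val rootRunOKN_std
  root_hop_planarN rootV_norm_le rootV_mem_Q root_seed_planar_subset_Q mem_rootCore_zero)
open SkelI (tanOff deepCtr exitDir cubeU slabGeomDeep)

variable {V : Type} [DecidableEq V] {G : SimpleGraph V} [G.LocallyFinite] (Φ : PlanarSkeletonConc G)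
variable {C : PCells} {w₀ : V} {Λ : ConcRadiiG} {q : unitInterval} {δc : ℝ}

/-! ## §1 The kit clauses of the root run -/

section Clauses

variable {Rt L' t R' ℓ₀ Rlev N j₀ j₁ : ℕ} {du : MDir} {ca cb q' : ℤ}

omit [DecidableEq V] in
/-- **The level boxes of the root run are `2 T₀` wide** once `T₀ ≤ j` (the `j`-enlargement of core `k`: along the axis its width is exactly `2j`).
[folklore] -/
theorem hwide_rootWAD (h : RootRunOK C t R' ℓ₀ ca cb q') {Sfin : Finset V} (k : ℕ) {ℓs M j : ℕ} (hj : tanOff ℓs M ≤ j) :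
    ∀ i, ((rootWAD Φ w₀ Rt L' du t R' ℓ₀ ca cb q' Rlev N j₀ j₁ Sfin).alo k - (j : Site 2)) i + 2 * tanOff ℓs M ≤
      ((rootWAD Φ w₀ Rt L' du t R' ℓ₀ ca cb q' Rlev N j₀ j₁ Sfin).ahi k + (j : Site 2)) i := by
  intro i
  have hle := (Finset.nonempty_Icc.1 (WinAdvData.acore_nonempty (P := rootWAD Φ w₀ Rt L' du t R' ℓ₀ ca cb q' Rlev N j₀ j₁ Sfin)
    (sgOf_sign du) (rootRun_advOK h) k)) i
  have hj' : ((tanOff ℓs M : ℕ) : ℤ) ≤ j := by exact_mod_cast hj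
  change (WinAdvData.alo _ k) i ≤ (WinAdvData.ahi _ k) i at hle
  simp only [Pi.sub_apply, Pi.add_apply, Pi.natCast_apply]
  linarith

/-- **The cube centre of a near contact projects into the level box** (indeed into its `2ℓs + 2`-shrunk shell, p3-g4's `cube_subset_shellWin`).
[folklore] -/
theorem φ_cubeCtr_mem_levelBox [Countable V] {p : unitInterval} (hC : Φ.toPlanarSkeleton.CylSubcritical p) {R : ℕ} {lo hi : Site 2}
    {j ℓs M r₀ : ℕ} (hwide : ∀ i, (lo - (j : Site 2)) i + 2 * tanOff ℓs M ≤ (hi + (j : Site 2)) i)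
    (hr₀ : 2 * ℓs + 2 + tanOff ℓs M + M + fatRadius Φ hC M ≤ r₀) (hR : r₀ ≤ R) {x : V}
    (hx : x ∈ outerBoundary (winGraph G w₀ R) (winLevel Φ w₀ R lo hi j))
    (hnear : inNbr Φ w₀ R (Finset.Icc (lo - (j : Site 2)) (hi + (j : Site 2))) x ∈ graphBall G w₀ (R - r₀)) :
    Φ.φ (cubeCtr Φ (deepCtr Φ w₀ R (lo - (j : Site 2)) (hi + (j : Site 2)) ℓs M x) (exitDir Φ w₀ R (lo - (j : Site 2)) (hi + (j : Site 2)) x).1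
        (exitDir Φ w₀ R (lo - (j : Site 2)) (hi + (j : Site 2)) x).2 ℓs M) ∈ Finset.Icc (lo - (j : Site 2)) (hi + (j : Site 2)) := by
  have hc := SkelI.cube_subset_shellWin Φ hC hwide hr₀ hR hx hnear ((mem_fatSeq_iff Φ hC).2 (self_mem_cylBall Φ _ _ _))
  exact SkelI.mem_Icc_of_mem_shell (Φ.mem_Win.1 hc).2

/-- **THE KIT CLAUSES OF THE ROOT RUN** (`hkits` of `Skel.rootOblA_of_rootRunSG` / `rootOblA_concSG_raw`, every direction): for `k ≤ 44` and
`j ∈ [j₀, j₁]`, the per-level kit clause of the window step `k` of `P = rootWAD … (rootUS …)` under the cut root law, from the Step-I input family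
at the running parameter (margin `δ²` over `Φ.types × Ssc`), the seed-kit constants, the counts, and the rim width `ψ(t+R') + ψ M ≤ L' ≤ Rt`.
[cite: KozmaNitzan2024, §4 Lemma 10 Steps III–IV (pp. 19–21), Lemma 11 (pp. 22–23), p. 28] -/
theorem hkits_rootWAD [Countable V] {p : unitInterval} (hC : Φ.toPlanarSkeleton.CylSubcritical p)
    (h : RootRunOKN C t R' ℓ₀ ca cb q') (hRB : Rt + 1 ≤ Λ.rB 0 0 du) (hRQ : Rt + 1 ≤ Λ.rQ 0 ((0 : Site 2) + stepVec du))
    (hRl : Rlev + 1 ≤ R') (hj : j₁ ≤ Rlev)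
    -- the Step-I inputs at the running parameter: kit scale `M`, route scales `[ℓ₀, t + R']`
    (msel : V → ℕ) {Ssc : Finset ℕ} {δ : ℝ} (hδ : 0 < δ)
    (hin : ∀ i ∈ inputIndex Φ Ssc, 1 - δ ^ 2 < (bondPercolation G q).real (inputEvent Φ hC msel i))
    {M : ℕ} (hM : M ∈ Ssc) (hmsel : ∀ τ ∈ Φ.types, msel τ ≤ M) (hMℓ₀ : M < ℓ₀) (hSsc : ∀ ℓ, ℓ₀ ≤ ℓ → ℓ ≤ t + R' → ℓ ∈ Ssc)
    -- the seed-kit constants (p1-g7's nine, `SkelI.kitClause_cube`), the level window above `T₀`, the near threshold inside the rim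
    {ℓs Rsd r₀ rs : ℕ} (hMℓ : M + 1 ≤ ℓs) (hj₀ : tanOff ℓs M ≤ j₀)
    (hR'₁ : Φ.cylRadMax ℓs (ℓs + 2 + 2 * tanOff ℓs M) ≤ Rsd) (hR'₂ : Φ.cylRadMax ℓs (ℓs + 2 + M + fatRadius Φ hC M) ≤ Rsd)
    (hr₀₁ : ℓs + 1 + tanOff ℓs M + Rsd ≤ r₀) (hr₀₂ : 2 * ℓs + 2 + tanOff ℓs M + M + fatRadius Φ hC M ≤ r₀) (hr₀L : r₀ ≤ L')
    (hrs₁ : ℓs + 2 + tanOff ℓs M + Rsd ≤ rs) (hrs₂ : 2 * ℓs + 3 + tanOff ℓs M + M + fatRadius Φ hC M ≤ rs)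
    -- the rim width against the route reach, the rim inside the window
    (hLψ : fatRadius Φ hC (t + R') + fatRadius Φ hC M ≤ L') (hLR : L' ≤ Rt)
    -- the counts
    (kk : ℕ) (hN : kk * (Φ.Δ + 1) ^ (2 * rs) ≤ N)
    (hk : (1 - (q : ℝ) ^ (1 + Φ.Δ * ((Φ.Δ + 1) ^ Rsd + (tanOff ℓs M + 2)) +
      ((Φ.Δ + 1) ^ Rsd + (tanOff ℓs M + 2)) * (Φ.Δ + 1) ^ fatRadius Φ hC M)) ^ kk ≤ δ)
    (P : WinAdvData V) (hP : P = rootWAD Φ w₀ Rt L' du t R' ℓ₀ ca cb q' Rlev N j₀ j₁ (rootUS Φ C w₀ Λ q δc Rt du))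
    {k : ℕ} (hk44 : k ≤ P.nA) {j : ℕ} (hjj : j ∈ Finset.Icc P.j₀ P.j₁) :
    ∃ (σ : KNLevels.SData V) (Sz : Finset V),
      KNLevels.SHyp (winLData Φ P.root P.Rπ (P.alo k) (P.ahi k) P.root P.Sfin) j σ ∧ σ.N ≤ P.N ∧
      (1 - (q : ℝ) ^ σ.sB) ^ σ.k ≤ δ ∧
      Sz ⊆ (winLData Φ P.root P.Rπ (P.alo k) (P.ahi k) P.root P.Sfin).X j ∧ Sz ⊆ P.stepD Φ k ∧
      (∀ x ∈ σ.K, ∀ e' ∈ σ.seed x, e' ∉ wireSet (↑Sz : Set V)) ∧ (∀ x ∈ σ.K, σ.face x ⊆ Sz) ∧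
      (∀ x ∈ σ.K, 1 - 3 * δ ≤ (prodBernoulli ((⟨cellGeomSG Φ C w₀ Λ, q, δc⟩ : KSchA V ℕ).W0sub G
          (rootUS Φ C w₀ Λ q δc Rt du))).real {ω | ∃ u ∈ σ.face x,
        1 - δ < (prodBernoulli (pinW ((⟨cellGeomSG Φ C w₀ Λ, q, δc⟩ : KSchA V ℕ).W0sub G (rootUS Φ C w₀ Λ q δc Rt du))
          (wireSet (↑Sz : Set V)) ω)).real
          (⋃ t' ∈ P.coreE Φ k, openConnIn (↑(P.stepD Φ k) : Set V) u t')}) := by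
  subst hP
  set U' := rootUS Φ C w₀ Λ q δc Rt du with hU'
  set P := rootWAD Φ w₀ Rt L' du t R' ℓ₀ ca cb q' Rlev N j₀ j₁ U' with hPdef
  change k ≤ 44 at hk44
  change j ∈ Finset.Icc j₀ j₁ at hjj
  have hj₁ : j ≤ j₁ := (Finset.mem_Icc.1 hjj).2
  have hjT : tanOff ℓs M ≤ j := hj₀.trans (Finset.mem_Icc.1 hjj).1
  have hsg : P.sg = 1 ∨ P.sg = -1 := sgOf_sign du
  have hOK : Adv.AdvOK P.q P.q' P.s₁ P.ρ P.R' P.ℓ₀ P.nA := rootRun_advOK h.toRootRunOK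
  have hR : r₀ ≤ Rt := hr₀L.trans hLR
  -- the region is a subbox of the window graph under the cut root law; the level lies in the region; the level box is wide
  have hWD : IsSubbox (winGraph G w₀ Rt) ((⟨cellGeomSG Φ C w₀ Λ, q, δc⟩ : KSchA V ℕ).W0sub G U') q (P.stepD Φ k) :=
    isSubbox_rootWAD Φ h hRB hRQ hk44
  have hXD : winLevel Φ w₀ Rt (P.alo k) (P.ahi k) j ⊆ P.stepD Φ k := WinAdvData.level_subset_stepD Φ P hsg hOK hRl hj hk44 hj₁
  have hwide : ∀ i, (P.alo k - (j : Site 2)) i + 2 * tanOff ℓs M ≤ (P.ahi k + (j : Site 2)) i := hwide_rootWAD Φ h.toRootRunOK k hjT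
  -- the enlarged target: true target over core (k+1), rim = the region's window vertices deeper than `Rt − L'`
  have hTpl : Φ.Win w₀ (P.acore (k + 1)) Rt ⊆ P.coreE Φ k := Finset.subset_union_left
  have hTrim : ∀ v ∈ winLevel Φ w₀ Rt (P.alo k) (P.ahi k) j, v ∉ graphBall G w₀ (Rt - L') → v ∈ P.coreE Φ k :=
    fun v hv hfar => Finset.mem_union_right _ (Finset.mem_filter.2 ⟨hXD hv, hfar⟩)
  -- the per-contact dichotomy from the planar room of the straight run
  have hcon := SkelI.hcon_win₂_of_roomO Φ hC (msel := msel) (Ssc := Ssc) (q := q) (δ := δ) (rs := rs)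
    (cU := (Φ.Δ + 1) ^ fatRadius Φ hC M)
    (Wt := (⟨cellGeomSG Φ C w₀ Λ, q, δc⟩ : KSchA V ℕ).W0sub G U') (D := P.stepD Φ k) (T := P.coreE Φ k) (Rt := Rt) (L'' := L')
    (Ldeep := fatRadius Φ hC (t + R')) (Unear := cubeU Φ hC w₀ Rt (P.alo k) (P.ahi k) j ℓs M) (fun x _ _ => rfl)
    (SkelI.nearFaceOK_cube Φ hC hMℓ hwide hR'₂ hr₀₂ hR hrs₂ le_rfl) hTrim (Nat.sub_le_sub_left hr₀L Rt) hLψ hLR le_rfl hWD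
    (Dpl := P.aregion k) (Tpl := P.acore (k + 1)) subset_rfl hTpl (fun x hx hnear => by
      have hmem := φ_cubeCtr_mem_levelBox Φ hC (w₀ := w₀) hwide hr₀₂ hR hx hnear
      obtain ⟨ℓ, hℓ₀, hℓ₁, hsq, a, τ', hface⟩ := ChainPlanar.Adv.levelBox_room hsg hOK hRl hj (ℓ₁ := t + R')
        (by change 2 * (0 : ℤ) + (t : ℤ) + R' ≤ ((t + R' : ℕ) : ℤ); push_cast; linarith) hk44 j hj₁ _ hmem
      exact ⟨ℓ, hSsc ℓ hℓ₀ hℓ₁, lt_of_lt_of_le hMℓ₀ hℓ₀, fatRadius_mono Φ hC hℓ₁, hsq, a, τ', hface⟩)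
  -- p1-g7's `kitClause` with p3-g4's cube faces (the body of `SkelI.kitClause_cube`, L5.9′)
  have hℓs : 1 ≤ ℓs := by omega
  have hR' : ∀ c : V, graphBall G c (ℓs + 2 + 2 * tanOff ℓs M) ∩ Φ.toPlanarSkeleton.cyl c ℓs ⊆ Φ.cylBall c ℓs Rsd :=
    fun c v hv => cylBall_mono Φ c le_rfl hR'₁ (Φ.prism_subset_cylBall c hℓs (ℓs + 2 + 2 * tanOff ℓs M) ⟨hv.1, hv.2⟩)
  exact SkelI.kitClause Φ hC msel hδ hin hM hmsel hℓs hwide hR' hr₀₁ hR hrs₁ (SkelI.nearFaceOK_cube Φ hC hMℓ hwide hR'₂ hr₀₂ hR hrs₂ le_rfl)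
    (fun x _ _ => rfl) (fun x hx u hu => (SkelI.cubeU_geom Φ hC hwide hx hu).2.2)
    (fun x hx hnear => ⟨SkelI.cube_subset_shellWin Φ hC hwide hr₀₂ hR hx hnear,
      SkelI.cubeU_subset_innerBoundary_win Φ hC hMℓ hwide hR'₂ hr₀₁ hr₀₂ hR hx hnear⟩) kk P.root P.Sfin hWD hXD hN hk hcon

end Clauses

/-! ## §2 The root residue with the kit clauses and the first-hop link discharged -/

/-- **THE ROOT RESIDUE OF THE CONCENTRIC SCHEME OF RECORD, KIT FORM**: `Skel.rootOblA_concSG_raw` (SkelConcRootAssembly) with its per-step kit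
clauses `hkits` discharged by `hkits_rootWAD` and its first-hop link `hlink` discharged from the same Step-I input family (scale `6t ∈ Ssc`, seed
`msel t ≤ M` at the first-hop centre, `m := M`).  Remaining hypotheses: planar numerics of the standard root run, radius facts, the count, the Step-I
inputs at margin `(δr 44)²` over `Φ.types × Ssc` with `{M, 6t} ∪ [ℓ₀, t+R'] ⊆ Ssc`, the seed-kit constants with `T₀ ≤ j₀` and `r₀ ≤ L'`, the rim
width `ψ(t+R') + ψ M ≤ L' ≤ Rt`, the kit counts, the excess radius at the running parameter, and the first-hop depths (`R₀ := 40t + ψ M`).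
[cite: KozmaNitzan2024, §4 p. 28 ((32) at the root), Lemma 9 (p. 16), Lemma 10 (pp. 17–21), Lemma 11 (pp. 22–23), Lemma 12 (p. 24)] -/
theorem rootOblA_concSG_kits [Countable V] (hΛ : WFS C Λ) (hφ : Φ.φ w₀ = 0) {p : unitInterval} (hC : Φ.toPlanarSkeleton.CylSubcritical p)
    {Δ' : ℕ} {δr : ℕ → ℝ} {Rt L' t R' ℓ₀ Rlev N j₀ j₁ M E₀' mex R₁ : ℕ}
    -- planar numerics of the standard root run
    (hr : (C.r : ℤ) = 4 * t) (hs : (R' : ℤ) + ℓ₀ ≤ t) (h100 : 100 * R' ≤ t) (hm : M + 47 * R' + 2 ≤ t) (ht : 1 ≤ t)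
    (hRl : Rlev + 1 ≤ R') (hj : j₁ ≤ Rlev)
    (P : MDir → WinAdvData V)
    (hP : ∀ du, P du = rootWAD Φ w₀ Rt L' du t R' ℓ₀ (26 * (t : ℤ) - M - 1) 0 (3 * (t : ℤ)) Rlev N j₀ j₁ (rootUS Φ C w₀ Λ q δc Rt du))
    -- radius facts
    (hRB : ∀ du, Rt + 1 ≤ Λ.rB 0 0 du) (hRQ : ∀ du, Rt + 1 ≤ Λ.rQ 0 ((0 : Site 2) + stepVec du))
    (hRM : ∀ du, Rt + 1 ≤ Λ.rM 0 ((0 : Site 2) + stepVec du)) (hRt : 60 * C.r ≤ Rt) (hQ0 : Λ.rQ 0 0 ≤ E₀')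
    -- the count
    (hcount : 1 / (1 - (q : ℝ)) ^ (Δ' * N) ≤ δr 44 * ((Finset.Icc j₀ j₁).card : ℝ))
    -- the Step-I inputs at the running parameter (kit scale `M`, route scales `[ℓ₀, t + R']`, first-hop scale `6t`)
    (msel : V → ℕ) {Ssc : Finset ℕ} (hδr : 0 < δr 44) (hδr1 : δr 44 ≤ 1)
    (hin : ∀ i ∈ inputIndex Φ Ssc, 1 - δr 44 ^ 2 < (bondPercolation G q).real (inputEvent Φ hC msel i))
    (hM : M ∈ Ssc) (h6t : 6 * t ∈ Ssc) (hmsel : ∀ τ ∈ Φ.types, msel τ ≤ M) (hMℓ₀ : M < ℓ₀)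
    (hSsc : ∀ ℓ, ℓ₀ ≤ ℓ → ℓ ≤ t + R' → ℓ ∈ Ssc)
    -- the seed-kit constants
    {ℓs Rsd r₀ rs : ℕ} (hMℓ : M + 1 ≤ ℓs) (hj₀ : tanOff ℓs M ≤ j₀)
    (hR'₁ : Φ.cylRadMax ℓs (ℓs + 2 + 2 * tanOff ℓs M) ≤ Rsd) (hR'₂ : Φ.cylRadMax ℓs (ℓs + 2 + M + fatRadius Φ hC M) ≤ Rsd)
    (hr₀₁ : ℓs + 1 + tanOff ℓs M + Rsd ≤ r₀) (hr₀₂ : 2 * ℓs + 2 + tanOff ℓs M + M + fatRadius Φ hC M ≤ r₀) (hr₀L : r₀ ≤ L')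
    (hrs₁ : ℓs + 2 + tanOff ℓs M + Rsd ≤ rs) (hrs₂ : 2 * ℓs + 3 + tanOff ℓs M + M + fatRadius Φ hC M ≤ rs)
    (hLψ : fatRadius Φ hC (t + R') + fatRadius Φ hC M ≤ L') (hLR : L' ≤ Rt)
    (kk : ℕ) (hN : kk * (Φ.Δ + 1) ^ (2 * rs) ≤ N)
    (hk : (1 - (q : ℝ) ^ (1 + Φ.Δ * ((Φ.Δ + 1) ^ Rsd + (tanOff ℓs M + 2)) +
      ((Φ.Δ + 1) ^ Rsd + (tanOff ℓs M + 2)) * (Φ.Δ + 1) ^ fatRadius Φ hC M)) ^ kk ≤ δr 44)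
    -- the rim excess: an excess radius at the running parameter
    {η : ℝ} (hη : η ≤ δr 44 / 2) (hmex : 60 * C.r ≤ mex)
    (hR₁ : ∀ R'', R₁ ≤ R'' → ∀ (Rw : ℕ) (D' A' : Finset V), (∀ d ∈ D', d ∈ graphBall G w₀ Rw) →
      (∀ d ∈ D', ∀ d' ∈ D', Φ.φ d - Φ.φ d' ∈ box 2 mex) → A' ⊆ D' → (∀ a ∈ A', a ∈ graphBall G w₀ (E₀' + 1)) →
        (bondPercolation G q).real (excess G w₀ R'' D' A') ≤ η)
    (hR : R₁ ≤ Rt - L')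
    -- the first hop: the depths of the seed window (`R₀ := 40t + ψ M`) and of the scale-`6t` prism
    (hR₀Q : 40 * t + fatRadius Φ hC M + 1 ≤ Λ.rQ 0 0) (hR₀t : 40 * t + fatRadius Φ hC M ≤ Rt)
    (hDQ : 40 * t + fatRadius Φ hC (6 * t) + 1 ≤ Λ.rQ 0 0) (hDB : ∀ du, 40 * t + fatRadius Φ hC (6 * t) + 1 ≤ Λ.rB 0 0 du)
    (hDt : 40 * t + fatRadius Φ hC (6 * t) ≤ Rt) :
    RootOblA Φ (⟨cellGeomSG Φ C w₀ Λ, q, δc⟩ : KSchA V ℕ) Δ' δr := by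
  have hnA : ∀ du, (P du).nA = 44 := fun du => by rw [hP]; rfl
  have hOK : ∀ du : MDir, RootRunOKN C t R' ℓ₀ (26 * (t : ℤ) - M - 1) 0 (3 * (t : ℤ)) := fun _ => rootRunOKN_std hr hs h100 hm
  refine rootOblA_concSG_raw Φ hΛ hφ hC hr hs h100 hm ht hRl hj P hP hRB hRQ hRM hRt hQ0 hcount (fun du k hkA j hjj => ?_) hη hmex hR₁ hR
    (R₀ := 40 * t + fatRadius Φ hC M) le_self_add hR₀Q hR₀t hDQ hDB hDt (fun du c hφc hcb => ?_)
  · -- the kit clauses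
    have hδ : 0 < δr (P du).nA := by rw [hnA]; exact hδr
    have hin' : ∀ i ∈ inputIndex Φ Ssc, 1 - δr (P du).nA ^ 2 < (bondPercolation G q).real (inputEvent Φ hC msel i) := by rw [hnA]; exact hin
    have hk' : (1 - (q : ℝ) ^ (1 + Φ.Δ * ((Φ.Δ + 1) ^ Rsd + (tanOff ℓs M + 2)) +
        ((Φ.Δ + 1) ^ Rsd + (tanOff ℓs M + 2)) * (Φ.Δ + 1) ^ fatRadius Φ hC M)) ^ kk ≤ δr (P du).nA := by rw [hnA]; exact hk
    exact hkits_rootWAD Φ hC (hOK du) (hRB du) (hRQ du) hRl hj msel hδ hin' hM hmsel hMℓ₀ hSsc hMℓ hj₀ hR'₁ hR'₂ hr₀₁ hr₀₂ hr₀L hrs₁ hrs₂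
      hLψ hLR kk hN hk' (P du) (hP du) hkA hjj
  · -- the first-hop link at the centre `c` over `rootV du t M`: a representative's inputs transported to `c`
    obtain ⟨τ, hτ, hall⟩ := exists_inputs_at_center_all Φ hC msel hin c
    have hnorm : (rootV du t M 0).natAbs + (rootV du t M 1).natAbs ≤ 40 * t := rootV_norm_le du t M (by omega)
    have hcb' : c ∈ graphBall G w₀ (40 * t) := graphBall_mono G w₀ hnorm hcb
    refine ⟨msel τ, (fatSeq_monotone Φ hC c (hmsel τ hτ)).trans ?_, ?_⟩
    · -- the seed prism `fatSeq c M` lies in the window over `C.Q 0` of depth `40t + ψ M`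
      refine fatSeq_subset_Win Φ hC (fun v hv => BoxProdZ2.mem_graphBall_add G hcb' hv) fun y hy => ?_
      rw [hφc, add_comm]
      exact root_seed_planar_subset_Q hr du (by omega) (Finset.mem_image.2 ⟨y, hy, rfl⟩)
    · have h2 := ((hall (6 * t) h6t).2 (faceElt du.1 (sgUnit du)))
      have hsq : δr 44 ^ 2 ≤ δr 44 := by nlinarith
      linarith

end Skel

end Transplant

end Summit.CriticalPhenomena.PercolationContinuityZ3.Theorems

end
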